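import Summits.RiemannHypothesis.RiemannHypothesis.Theorems.TiltedLandingLaw421R3Lens1MeridianGerm

/-!
# IMAGE «Lens1MeridianCrit» v1 (lens-1 g12) — CRITICAL DESCENT, the last analytic input of the lift (G) of #172's (B1)

On top of #180 «Lens1MeridianLocal» ((L2) `regularArc`) and «Lens1MeridianGerm» (`paySet`, `meridianComponent`):
* `local_root_normal_form`: an analytic `φ` not locally constant at `z₀` is `φ z₀ + hᵏ` near `z₀`, `k ≥ 1`, `h` analytic, `h z₀ = 0 ≠ h′ z₀`
  (order of `φ − φ z₀` via `AnalyticAt.analyticOrderAt_eq_natCast`; k-th root of the non-vanishing cofactor as `c·exp (log (u/u z₀)/k)`, `log` analytic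
  near `1`);
* (L5) `critical_descent`: at a point `z₀ ≠ T` of the meridian component in the OPEN half-disc where `φ = phiAt f j` is analytic and not locally
  constant, the component contains a pay point with strictly SMALLER `Im φ` — no hypothesis on `φ′ z₀` ((L4) `regular_descent` is the case `k = 1`):
  (L2) applied to `ψ := h·(I/ω)`, `ωᵏ = −I`, gives an arc from `z₀` along which `φ = φ z₀ − i tᵏ`.
So a minimiser of `Im φ` over the component is never an interior point where `f^{(j)} ≠ 0` and `Im φ > 0`.  (B1)/(B2), stub 1′ and ⟨27010⟩ stay
OPEN; RH is not proved; nothing here asserts an open law.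
-/

namespace RhW08.Lens1MeridianCrit

open Complex Set Metric RhW08.Lens1ArcSign RhW08.Lens1MeridianLocal RhW08.Lens1MeridianGerm

/-- LOCAL ROOT NORMAL FORM: an analytic `φ` not locally constant at `z₀` is `φ z₀ + hᵏ` near `z₀` for some `k ≥ 1` and an analytic `h` with
`h z₀ = 0`, `h′ z₀ ≠ 0`. -/
theorem local_root_normal_form {φ : ℂ → ℂ} {z₀ : ℂ} (ha : AnalyticAt ℂ φ z₀) (hnc : ¬ (∀ᶠ z in nhds z₀, φ z = φ z₀)) :
    ∃ k : ℕ, 1 ≤ k ∧ ∃ h : ℂ → ℂ, AnalyticAt ℂ h z₀ ∧ h z₀ = 0 ∧ deriv h z₀ ≠ 0 ∧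
      ∀ᶠ z in nhds z₀, φ z = φ z₀ + h z ^ k := by
  set g : ℂ → ℂ := fun z => φ z - φ z₀ with hg
  have hga : AnalyticAt ℂ g z₀ := ha.sub analyticAt_const
  have hfin : analyticOrderAt g z₀ ≠ ⊤ := by
    intro htop
    apply hnc
    filter_upwards [analyticOrderAt_eq_top.mp htop] with z hz
    exact sub_eq_zero.mp hz
  obtain ⟨k, hk⟩ := ENat.ne_top_iff_exists.mp hfin
  have hk0 : k ≠ 0 := by
    intro h0; rw [h0] at hk
    exact (hga.analyticOrderAt_ne_zero.mpr (by simp [hg])) (by exact_mod_cast hk.symm)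
  obtain ⟨u, hua, hu0, hfac⟩ := (hga.analyticOrderAt_eq_natCast).mp hk.symm
  -- k-th root of `u` near `z₀`: `v = c · exp (log (u/u z₀) / k)`, `cᵏ = u z₀`
  set c : ℂ := u z₀ ^ ((k : ℂ)⁻¹) with hc
  have hck : c ^ k = u z₀ := by rw [hc]; exact Complex.cpow_nat_inv_pow _ hk0
  have hc0 : c ≠ 0 := fun h0 => hu0 (by rw [← hck, h0, zero_pow hk0])
  set q : ℂ → ℂ := fun z => u z / u z₀ with hq
  have hqa : AnalyticAt ℂ q z₀ := hua.div analyticAt_const hu0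
  have hq0 : q z₀ = 1 := div_self hu0
  have hloga : AnalyticAt ℂ (fun z => Complex.log (q z)) z₀ :=
    (analyticAt_clog (by rw [hq0]; exact Complex.one_mem_slitPlane)).comp hqa
  set v : ℂ → ℂ := fun z => c * Complex.exp (Complex.log (q z) / k) with hv
  have hva : AnalyticAt ℂ v z₀ := analyticAt_const.mul ((hloga.div analyticAt_const (by exact_mod_cast hk0)).cexp)
  have hvz₀ : v z₀ = c := by simp [hv, hq0]
  -- near `z₀`, `u ≠ 0` hence `vᵏ = u`
  obtain ⟨r₁, hr₁, hu₁⟩ := Metric.eventually_nhds_iff_ball.mp (hua.continuousAt.eventually_ne hu0)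
  have hvk : ∀ z ∈ ball z₀ r₁, v z ^ k = u z := by
    intro z hz
    have hqz : q z ≠ 0 := div_ne_zero (hu₁ z hz) hu0
    rw [hv]; dsimp only
    rw [mul_pow, ← Complex.exp_nat_mul, mul_div_cancel₀ _ (by exact_mod_cast hk0), Complex.exp_log hqz, hck, hq]
    field_simp
  refine ⟨k, Nat.one_le_iff_ne_zero.mpr hk0, fun z => (z - z₀) * v z, ?_, by simp, ?_, ?_⟩
  · exact ((analyticAt_id).sub analyticAt_const).mul hva
  · have h1 : HasDerivAt (fun z => (z - z₀) * v z) (1 * v z₀ + (z₀ - z₀) * deriv v z₀) z₀ :=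
      ((hasDerivAt_id z₀).sub_const z₀).mul hva.differentiableAt.hasDerivAt
    rw [h1.deriv, sub_self, zero_mul, add_zero, one_mul, hvz₀]; exact hc0
  · obtain ⟨r₂, hr₂, hfac₂⟩ := Metric.eventually_nhds_iff_ball.mp hfac
    have hr : 0 < min r₁ r₂ := lt_min hr₁ hr₂
    filter_upwards [Metric.ball_mem_nhds z₀ hr] with z hz
    have e := hfac₂ z (Metric.ball_subset_ball (min_le_right _ _) hz)
    rw [smul_eq_mul] at e
    rw [mul_pow, hvk z (Metric.ball_subset_ball (min_le_left _ _) hz), ← e, hg]; ring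

/-- (L5) CRITICAL DESCENT (by (L2) `regularArc`, #180): at a point `z₀ ≠ T` of the meridian component in the open half-disc where `φ` is analytic and not
locally constant, the component contains a point with strictly smaller `Im φ`. -/
theorem critical_descent (f : ℂ → ℂ) (j : ℕ) (T z₀ : ℂ) (hz₀ : z₀ ∈ meridianComponent f j T) (hzT : z₀ ≠ T)
    (hdisc : (z₀.re - T.re) ^ 2 + z₀.im ^ 2 < T.im ^ 2) (him₀ : 0 < z₀.im) (ha : AnalyticAt ℂ (phiAt f j) z₀)
    (hnc : ¬ (∀ᶠ z in nhds z₀, phiAt f j z = phiAt f j z₀)) :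
    ∃ z ∈ meridianComponent f j T, 0 < (phiAt f j z).im ∧ (phiAt f j z).im < (phiAt f j z₀).im := by
  have hpay : (phiAt f j z₀).re = 0 ∧ 0 < (phiAt f j z₀).im := by
    rcases connectedComponentIn_subset _ _ hz₀ with h | h
    · exact h.2
    · exact absurd (Set.mem_singleton_iff.mp h) hzT
  set t₀ := (phiAt f j z₀).im with ht₀
  obtain ⟨k, hk1, h, hha, hh0, hhd, hnfE⟩ := local_root_normal_form ha hnc
  obtain ⟨r₁, hr₁, hnf⟩ := Metric.eventually_nhds_iff_ball.mp hnfE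
  have hk0 : k ≠ 0 := by omega
  -- `ωᵏ = −I`
  set ω : ℂ := (-I) ^ ((k : ℂ)⁻¹) with hω
  have hωk : ω ^ k = -I := by rw [hω]; exact Complex.cpow_nat_inv_pow _ hk0
  have hω0 : ω ≠ 0 := fun h0 => by rw [h0, zero_pow hk0] at hωk; exact I_ne_zero (neg_eq_zero.mp hωk.symm)
  -- `ψ := h · (I/ω)` is analytic with `ψ z₀ = 0`, `ψ′ z₀ ≠ 0`
  set ψ : ℂ → ℂ := fun z => h z * (I / ω) with hψ
  have hψa : AnalyticAt ℂ ψ z₀ := hha.mul analyticAt_const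
  have hψ0 : ψ z₀ = 0 := by simp [hψ, hh0]
  have hψd : deriv ψ z₀ ≠ 0 := by
    have h1 : HasDerivAt ψ (deriv h z₀ * (I / ω)) z₀ := hha.differentiableAt.hasDerivAt.mul_const _
    rw [h1.deriv]; exact mul_ne_zero hhd (div_ne_zero I_ne_zero hω0)
  obtain ⟨r, ρ, -, hρ, Z, hZc, hZ₀, hZψ, -⟩ := regularArc ψ z₀ hψa hψd
  rw [hψ0, Complex.zero_im, zero_sub, zero_add] at hZc hZψ
  rw [hψ0, Complex.zero_im] at hZ₀
  simp only [Complex.zero_re] at hZψ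
  -- along the arc: `φ (Z t) = φ z₀ − I tᵏ`
  have hval : ∀ t ∈ Ioo (-ρ) ρ, Z t ∈ ball z₀ r₁ →
      (phiAt f j (Z t)).re = (phiAt f j z₀).re ∧ (phiAt f j (Z t)).im = (phiAt f j z₀).im - t ^ k := by
    intro t ht hball
    have hψt := hZψ t ht
    have hht : h (Z t) = (t : ℂ) * ω := by
      have e : h (Z t) * (I / ω) = ⟨0, t⟩ := hψt
      have e2 : (⟨0, t⟩ : ℂ) = (t : ℂ) * I := by apply Complex.ext <;> simp
      rw [e2] at e
      field_simp at e
      linear_combination e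
    have hφt : phiAt f j (Z t) = phiAt f j z₀ + ((t ^ k : ℝ) : ℂ) * (-I) := by
      rw [hnf _ hball, hht, mul_pow, hωk]; push_cast; ring
    rw [hφt, Complex.add_re, Complex.add_im, Complex.mul_re, Complex.mul_im, Complex.ofReal_re, Complex.ofReal_im, Complex.neg_re,
      Complex.neg_im, Complex.I_re, Complex.I_im]
    constructor <;> ring
  -- a neighbourhood: open half-disc ∩ the normal-form ball
  have hU : IsOpen ({z : ℂ | (z.re - T.re) ^ 2 + z.im ^ 2 < T.im ^ 2 ∧ 0 < z.im} ∩ ball z₀ r₁) :=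
    ((isOpen_lt (((Complex.continuous_re.sub continuous_const).pow 2).add (Complex.continuous_im.pow 2)) continuous_const).inter
      (isOpen_lt continuous_const Complex.continuous_im)).inter Metric.isOpen_ball
  have hZat : ContinuousAt Z 0 := hZc.continuousAt (Ioo_mem_nhds (by linarith) hρ)
  have hpre : Z ⁻¹' ({z : ℂ | (z.re - T.re) ^ 2 + z.im ^ 2 < T.im ^ 2 ∧ 0 < z.im} ∩ ball z₀ r₁) ∈ nhds (0 : ℝ) :=
    hZat.preimage_mem_nhds (hU.mem_nhds (by rw [hZ₀]; exact ⟨⟨hdisc, him₀⟩, Metric.mem_ball_self hr₁⟩))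
  obtain ⟨δ, hδ, hδU⟩ := Metric.mem_nhds_iff.mp hpre
  -- the parameter length: `δ' < δ, ρ, 1` and `δ'ᵏ ≤ δ' < t₀`
  set δ' := min (min δ ρ) (min t₀ 1) / 2 with hδ'def
  have hm : 0 < min (min δ ρ) (min t₀ 1) := lt_min (lt_min hδ hρ) (lt_min hpay.2 one_pos)
  have hδ' : 0 < δ' := by positivity
  have hδ'δ : δ' < δ := by rw [hδ'def]; linarith [min_le_left (min δ ρ) (min t₀ 1), min_le_left δ ρ]
  have hδ'ρ : δ' < ρ := by rw [hδ'def]; linarith [min_le_left (min δ ρ) (min t₀ 1), min_le_right δ ρ]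
  have hδ't : δ' < t₀ := by rw [hδ'def]; linarith [min_le_right (min δ ρ) (min t₀ 1), min_le_left t₀ 1]
  have hδ'1 : δ' < 1 := by rw [hδ'def]; linarith [min_le_right (min δ ρ) (min t₀ 1), min_le_right t₀ 1]
  have hpowle : ∀ t : ℝ, 0 ≤ t → t ≤ δ' → t ^ k ≤ δ' := fun t ht0 htδ =>
    (pow_le_pow_left₀ ht0 htδ k).trans (pow_le_of_le_one hδ'.le hδ'1.le hk0)
  have hJ : Icc 0 δ' ⊆ Ioo (-ρ) ρ := fun t ht => ⟨by linarith [ht.1], by linarith [ht.2]⟩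
  have hJU : ∀ t ∈ Icc 0 δ', Z t ∈ {z : ℂ | (z.re - T.re) ^ 2 + z.im ^ 2 < T.im ^ 2 ∧ 0 < z.im} ∩ ball z₀ r₁ := fun t ht =>
    hδU (by rw [Metric.mem_ball, Real.dist_eq, sub_zero, abs_lt]; constructor <;> linarith [ht.1, ht.2])
  have hconn : IsPreconnected (Z '' Icc 0 δ') := isPreconnected_Icc.image _ (hZc.mono hJ)
  have hsub : Z '' Icc 0 δ' ⊆ paySet f j T := by
    rintro z ⟨t, ht, rfl⟩
    have htU := hJU t ht
    have hφ := hval t (hJ ht) htU.2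
    left
    refine ⟨⟨htU.1.1.le, htU.1.2.le⟩, ?_, ?_⟩
    · rw [hφ.1, hpay.1]
    · rw [hφ.2]; linarith [hpowle t ht.1 ht.2]
  have hz₀mem : z₀ ∈ Z '' Icc 0 δ' := ⟨0, ⟨le_rfl, hδ'.le⟩, hZ₀⟩
  have hcomp : Z '' Icc 0 δ' ⊆ meridianComponent f j T := by
    have hc := hconn.subset_connectedComponentIn hz₀mem hsub
    unfold meridianComponent; rw [connectedComponentIn_eq hz₀]; exact hc
  refine ⟨Z δ', hcomp ⟨δ', ⟨hδ'.le, le_rfl⟩, rfl⟩, ?_, ?_⟩ <;>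
    rw [(hval δ' (hJ ⟨hδ'.le, le_rfl⟩) (hJU δ' ⟨hδ'.le, le_rfl⟩).2).2]
  · linarith [hpowle δ' hδ'.le le_rfl]
  · linarith [pow_pos hδ' k]

end RhW08.Lens1MeridianCrit
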